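import Summits.NavierStokesRegularity.NavierStokesRegularity.Theorems.SoloRefuteLindgren2012Witness
import Literature.Analysis.FluidPDE.NSVorticityBKMLocalExistence
import Mathlib.MeasureTheory.Measure.Lebesgue.Basic

/-!
# C32 `Lindgren2012` — refutation of Step 4 ((26), TeX l.157–161, print p.3)

J. Lindgren, *Regular solutions of the Navier–Stokes equations in ℝ³*, arXiv 1207.1090 v3 (2012).
The load-bearing step (26): «Now it seems that the enstrophy here depends on the orthogonal part of
the velocity field. This cannot be the case and is a clear contradiction, therefore it must be so
that the integral involving the perpendicular part vanishes», i.e. `∫ ⟨ω, (∇×ω) × u_⊥⟩ = 0` for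
every admissible field — typed (p479581) as
`Literature.Claims.NS.Lindgren2012.Step4_VanishingIntegral_kinematic` (every `IsDatum` field) and
`Step4_VanishingIntegral` (every time slice of every solution of the class). Both are FALSE
(class: false lemma, countermodel): for the explicit datum `wit` of
`SoloRefuteLindgren2012Witness.lean` (smooth, compactly supported, divergence free),
`∫ ⟨ω, (∇×ω) × u_⊥⟩ = ∫ ⟨ω, (∇×ω) × v⟩` (skeleton's `stretchPerp_eq`, since `u_∥ ∥ ∇×ω`)
`= −(20/81) · M`, `M = ∫ χ(|y|²) χ'(|y|²)² y₀² y₁² dy > 0` (`stretch_wit`, `integral_mom_pos`):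
the integrand splits into a part odd in `y₀` and a part odd in `y₁` (each integrates to `0` by a
coordinate reflection, `integral_eq_zero_of_odd`) and an even part
`χχ'²(Q)(−16/27 y₀²y₁² + 8 y₀²y₂² − 80 y₁²y₂²)`, which the substitution `y = (Y₀, Y₁/2, Y₂/3)`
(`integral_comp_diagonal`) and coordinate permutations (`integral_comp_swap`) reduce to
`(1/6)(−4/27 + 8/9 − 20/9) M`. Hence `not_Step4_VanishingIntegral_kinematic`; evolving `wit` by
the proved local existence theorem in the Beale–Kato–Majda class
(`MajdaBertozzi2002_localExistenceH3_holds`, `ν = 1`) gives `not_Step4_VanishingIntegral`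
(the time-`0` slice). Steps 1, 2, 5 are kernel-true (`Theorems/SoloSalvageLindgren2012.lean`,
salvage-p3 g2); Step 3 (enstrophy evolution) and Step 6 (enstrophy bound ⇒ regularity) are
classical and not attacked; `ClaimedTheorem` is Clay-strength and is not decided here.

WHAT THIS IS NOT: not a claim about NS regularity or blow-up; not a claim about any author beyond
the typed locator.
-/

set_option linter.dupNamespace false

noncomputable section

open Set Filter Function WithLp MeasureTheory
open scoped Topology RealInnerProductSpace ContDiff
open Literature.Analysis.FluidPDE
open Literature.Claims.NS.Lindgren2012

namespace Summit.NavierStokesRegularity.NavierStokesRegularity.Theorems.Lindgren2012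

/-! ### Plain-coordinate form of the integrand and its parity decomposition -/

/-- `Q` in plain coordinates. [folklore] -/
def qK (y : Fin 3 → ℝ) : ℝ := y 0 ^ 2 + 4 * y 1 ^ 2 + 9 * y 2 ^ 2

/-- `|y|²` in plain coordinates. [folklore] -/
def qI (y : Fin 3 → ℝ) : ℝ := y 0 ^ 2 + y 1 ^ 2 + y 2 ^ 2

/-- The weight `χχ'²`. [folklore] -/
def wA (q : ℝ) : ℝ := chi q * chi₁ q ^ 2

/-- The weight `χ²χ'`. [folklore] -/
def wB (q : ℝ) : ℝ := chi q ^ 2 * chi₁ q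

/-- The part of the integrand that is even in every coordinate. [folklore] -/
def gE (y : Fin 3 → ℝ) : ℝ :=
  wA (qK y) * (-(16 / 27) * y 0 ^ 2 * y 1 ^ 2 + 8 * y 0 ^ 2 * y 2 ^ 2 - 80 * y 1 ^ 2 * y 2 ^ 2)

/-- The part of the integrand that is odd in `y₀`. [folklore] -/
def gX (y : Fin 3 → ℝ) : ℝ :=
  wA (qK y) * (-68 * y 0 * y 2 ^ 3 + (297 / 2) * y 0 * y 1 * y 2 ^ 2
      - (1024 / 9) * y 0 * y 1 ^ 2 * y 2 + (656 / 27) * y 0 * y 1 ^ 3 - (388 / 81) * y 0 ^ 3 * y 2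
      + (97 / 54) * y 0 ^ 3 * y 1)
    + wB (qK y) * (-(1156 / 81) * y 0 * y 2 + (289 / 54) * y 0 * y 1)

/-- The part of the integrand that is even in `y₀` and odd in `y₁`. [folklore] -/
def gY (y : Fin 3 → ℝ) : ℝ :=
  wA (qK y) * ((85 / 2) * y 1 * y 2 ^ 3 + (3280 / 81) * y 1 ^ 3 * y 2
      + (85 / 54) * y 0 ^ 2 * y 1 * y 2)
    + wB (qK y) * ((1445 / 162) * y 1 * y 2)

/-- Parity decomposition of the integrand. [folklore] -/
theorem integrandF_eq (y : Fin 3 → ℝ) :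
    integrandF (y 0 ^ 2 + 4 * y 1 ^ 2 + 9 * y 2 ^ 2) (y 0) (y 1) (y 2) = gE y + gX y + gY y := by
  simp only [integrandF, P₁, P₂, gE, gX, gY, wA, wB, qK]
  ring

/-! ### Continuity, support, integrability -/

/-- `χ` is continuous. [folklore] -/
theorem continuous_chi : Continuous chi := chi_contDiff.continuous

/-- `χ'` is continuous. [folklore] -/
theorem continuous_chi₁ : Continuous chi₁ := chi₁_contDiff.continuous

/-- `yᵢ² ≤ |y|²`. [folklore] -/
theorem sq_le_qI (y : Fin 3 → ℝ) (i : Fin 3) : y i ^ 2 ≤ qI y := by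
  have h := Finset.single_le_sum (fun j _ => sq_nonneg (y j)) (Finset.mem_univ i)
  rw [Fin.sum_univ_three] at h
  simpa [qI] using h

/-- `yᵢ² ≤ Q(y)`. [folklore] -/
theorem sq_le_qK (y : Fin 3 → ℝ) (i : Fin 3) : y i ^ 2 ≤ qK y := by
  have h := sq_le_qI y i
  simp only [qI, qK] at h ⊢
  nlinarith [sq_nonneg (y 1), sq_nonneg (y 2)]

/-- Outside the sup-norm ball of radius `2` some coordinate has square `> 4`. [folklore] -/
theorem exists_sq_gt {y : Fin 3 → ℝ} (hy : y ∉ Metric.closedBall (0 : Fin 3 → ℝ) 2) :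
    ∃ i, 4 < y i ^ 2 := by
  rw [Metric.mem_closedBall, dist_zero_right, pi_norm_le_iff_of_nonneg (by norm_num)] at hy
  simp only [not_forall, not_le, Real.norm_eq_abs] at hy
  obtain ⟨i, hi⟩ := hy
  exact ⟨i, by nlinarith [abs_nonneg (y i), sq_abs (y i)]⟩

/-- A function with a factor `χ(q y)`, `q ≥ yᵢ²`, has compact support. [folklore] -/
theorem hasCompactSupport_of_chi_factor {q : (Fin 3 → ℝ) → ℝ} (hq : ∀ y i, y i ^ 2 ≤ q y)
    {g : (Fin 3 → ℝ) → ℝ} (h : ∀ y, chi (q y) = 0 → g y = 0) : HasCompactSupport g := by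
  refine HasCompactSupport.intro (isCompact_closedBall (0 : Fin 3 → ℝ) 2) fun y hy => h y ?_
  obtain ⟨i, hi⟩ := exists_sq_gt hy
  exact chi_eq_zero (by linarith [hq y i])

/-- `g_E` is continuous. [folklore] -/
theorem continuous_gE : Continuous gE := by
  have := continuous_chi; have := continuous_chi₁; unfold gE wA qK; fun_prop

/-- `g_X` is continuous. [folklore] -/
theorem continuous_gX : Continuous gX := by
  have := continuous_chi; have := continuous_chi₁; unfold gX wA wB qK; fun_prop

/-- `g_Y` is continuous. [folklore] -/
theorem continuous_gY : Continuous gY := by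
  have := continuous_chi; have := continuous_chi₁; unfold gY wA wB qK; fun_prop

/-- `g_E` has compact support. [folklore] -/
theorem hasCompactSupport_gE : HasCompactSupport gE :=
  hasCompactSupport_of_chi_factor sq_le_qK fun y h => by simp [gE, wA, h]

/-- `g_X` has compact support. [folklore] -/
theorem hasCompactSupport_gX : HasCompactSupport gX :=
  hasCompactSupport_of_chi_factor sq_le_qK fun y h => by simp [gX, wA, wB, h]

/-- `g_Y` has compact support. [folklore] -/
theorem hasCompactSupport_gY : HasCompactSupport gY :=
  hasCompactSupport_of_chi_factor sq_le_qK fun y h => by simp [gY, wA, wB, h]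

/-! ### Linear changes of variables on `ℝ³` -/

/-- Diagonal change of variables for Lebesgue measure on `Fin 3 → ℝ`:
`∫ f = |d₀d₁d₂| ∫ f(d₀y₀, d₁y₁, d₂y₂) dy`. [folklore] -/
theorem integral_comp_diagonal (D : Fin 3 → ℝ) (hD : ∀ i, D i ≠ 0) {f : (Fin 3 → ℝ) → ℝ}
    (hf : Continuous f) :
    ∫ y, f y = |∏ i, D i| * ∫ y : Fin 3 → ℝ, f (fun i => D i * y i) := by
  have hdet : (Matrix.diagonal D).det ≠ 0 := by
    rw [Matrix.det_diagonal]
    exact Finset.prod_ne_zero_iff.mpr fun i _ => hD i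
  have h := Real.smul_map_diagonal_volume_pi hdet
  have hT : AEMeasurable (⇑(Matrix.toLin' (Matrix.diagonal D))) (volume : Measure (Fin 3 → ℝ)) :=
    (LinearMap.continuous_of_finiteDimensional _).measurable.aemeasurable
  conv_lhs => rw [← h]
  rw [integral_smul_measure, integral_map hT hf.aestronglyMeasurable, Matrix.det_diagonal,
    ENNReal.toReal_ofReal (abs_nonneg _), smul_eq_mul]
  congr 1
  refine integral_congr_ae (Eventually.of_forall fun y => ?_)
  simp only [Matrix.toLin'_apply]
  congr 1
  funext i
  rw [Matrix.mulVec_diagonal]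

/-- A continuous function that is odd under the reflection of one coordinate integrates to zero.
[folklore] -/
theorem integral_eq_zero_of_odd (D : Fin 3 → ℝ) (hD : ∀ i, D i = 1 ∨ D i = -1)
    {f : (Fin 3 → ℝ) → ℝ} (hf : Continuous f) (hodd : ∀ y, f (fun i => D i * y i) = -f y) :
    ∫ y, f y = 0 := by
  have h := integral_comp_diagonal D (fun i => by rcases hD i with h | h <;> rw [h] <;> norm_num) hf
  have habs : |∏ i, D i| = 1 := by
    rw [Finset.abs_prod]
    exact Finset.prod_eq_one fun i _ => by rcases hD i with h | h <;> rw [h] <;> norm_num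
  simp_rw [habs, one_mul, hodd, integral_neg] at h
  linarith

/-- `∫ g_X = 0` (reflection `y₀ ↦ −y₀`). [folklore] -/
theorem integral_gX : ∫ y, gX y = 0 := by
  refine integral_eq_zero_of_odd ![-1, 1, 1] (fun i => by fin_cases i <;> simp) continuous_gX
    fun y => ?_
  simp only [gX, wA, wB, qK]
  simp
  ring

/-- `∫ g_Y = 0` (reflection `y₁ ↦ −y₁`). [folklore] -/
theorem integral_gY : ∫ y, gY y = 0 := by
  refine integral_eq_zero_of_odd ![1, -1, 1] (fun i => by fin_cases i <;> simp) continuous_gY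
    fun y => ?_
  simp only [gY, wA, wB, qK]
  simp
  ring

/-- Permutation of coordinates preserves the integral. [folklore] -/
theorem integral_comp_swap (a b : Fin 3) (g : (Fin 3 → ℝ) → ℝ) :
    ∫ y : Fin 3 → ℝ, g (fun i => y (Equiv.swap a b i)) = ∫ y, g y := by
  have h :=
    (volume_measurePreserving_piCongrLeft (fun _ : Fin 3 => ℝ) (Equiv.swap a b)).integral_comp' g
  refine Eq.trans (integral_congr_ae (Eventually.of_forall fun y => ?_)) h
  show g _ = g _
  congr 1
  funext i
  simp [MeasurableEquiv.piCongrLeft, Equiv.piCongrLeft_apply_eq_cast]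

/-! ### The even part: reduction to one radial moment -/

/-- The radial pair moment integrand `χ(|y|²)χ'(|y|²)² y₀² y₁²`. [folklore] -/
def mom (y : Fin 3 → ℝ) : ℝ := wA (qI y) * (y 0 ^ 2 * y 1 ^ 2)

/-- The moment integrand is continuous. [folklore] -/
theorem continuous_mom : Continuous mom := by
  have := continuous_chi; have := continuous_chi₁; unfold mom wA qI; fun_prop

/-- The moment integrand has compact support. [folklore] -/
theorem hasCompactSupport_mom : HasCompactSupport mom :=
  hasCompactSupport_of_chi_factor sq_le_qI fun y h => by simp [mom, wA, h]

/-- The moment integrand is non-negative (`χ ≥ 0`). [folklore] -/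
theorem mom_nonneg (y : Fin 3 → ℝ) : 0 ≤ mom y :=
  mul_nonneg (mul_nonneg (chi_nonneg _) (sq_nonneg _)) (by positivity)

/-- The pair moments with `y₀²y₂²` and `y₁²y₂²` equal the one with `y₀²y₁²`. [folklore] -/
theorem integral_mom02 :
    ∫ y : Fin 3 → ℝ, wA (qI y) * (y 0 ^ 2 * y 2 ^ 2) = ∫ y, mom y := by
  rw [← integral_comp_swap 1 2 mom]
  refine integral_congr_ae (Eventually.of_forall fun y => ?_)
  simp only [mom, qI, Equiv.swap_apply_left, Equiv.swap_apply_right,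
    Equiv.swap_apply_of_ne_of_ne (show (0 : Fin 3) ≠ 1 by decide) (show (0 : Fin 3) ≠ 2 by decide)]
  ring

/-- See `integral_mom02`. [folklore] -/
theorem integral_mom12 :
    ∫ y : Fin 3 → ℝ, wA (qI y) * (y 1 ^ 2 * y 2 ^ 2) = ∫ y, mom y := by
  rw [← integral_comp_swap 0 2 mom]
  refine integral_congr_ae (Eventually.of_forall fun y => ?_)
  simp only [mom, qI, Equiv.swap_apply_left, Equiv.swap_apply_right,
    Equiv.swap_apply_of_ne_of_ne (show (1 : Fin 3) ≠ 0 by decide) (show (1 : Fin 3) ≠ 2 by decide)]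
  ring

/-- The pair-moment integrands are integrable. [folklore] -/
theorem integrable_pair (i j : Fin 3) :
    Integrable fun y : Fin 3 → ℝ => wA (qI y) * (y i ^ 2 * y j ^ 2) := by
  have := continuous_chi; have := continuous_chi₁
  refine Continuous.integrable_of_hasCompactSupport (by unfold wA qI; fun_prop)
    (hasCompactSupport_of_chi_factor sq_le_qI fun y h => by simp [wA, h])

/-- **The even part in terms of the radial moment**: after `y = (Y₀, Y₁/2, Y₂/3)` and coordinate
permutations, `∫ g_E = (1/6)(−4/27 + 8/9 − 20/9) M = −(20/81) M`. [folklore] -/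
theorem integral_gE : ∫ y, gE y = -(20 / 81) * ∫ y, mom y := by
  rw [integral_comp_diagonal ![1, 1 / 2, 1 / 3] (fun i => by fin_cases i <;> simp) continuous_gE]
  have habs : |∏ i, (![1, 1 / 2, 1 / 3] : Fin 3 → ℝ) i| = 1 / 6 := by
    norm_num [Fin.prod_univ_three, Matrix.cons_val_two]
  have hsub : ∀ y : Fin 3 → ℝ, gE (fun i => ![(1 : ℝ), 1 / 2, 1 / 3] i * y i) =
      -(4 / 27) * (wA (qI y) * (y 0 ^ 2 * y 1 ^ 2)) + (8 / 9) * (wA (qI y) * (y 0 ^ 2 * y 2 ^ 2))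
        - (20 / 9) * (wA (qI y) * (y 1 ^ 2 * y 2 ^ 2)) := fun y => by
    simp only [gE, qK, qI]
    simp
    ring
  simp_rw [habs, hsub]
  rw [integral_sub, integral_add, integral_const_mul, integral_const_mul, integral_const_mul,
    integral_mom02, integral_mom12]
  · simp only [mom]
    ring
  · exact (integrable_pair 0 1).const_mul _
  · exact (integrable_pair 0 2).const_mul _
  · exact ((integrable_pair 0 1).const_mul _).add ((integrable_pair 0 2).const_mul _)
  · exact (integrable_pair 1 2).const_mul _

/-! ### Positivity of the radial moment -/

/-- By the mean value theorem there is `s ∈ (1, 2)` with `χ'(s) = -1` (and `χ(s) > 0`).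
[folklore] -/
theorem exists_chi₁_eq : ∃ s ∈ Ioo (1 : ℝ) 2, chi₁ s = -1 := by
  obtain ⟨s, hs, hds⟩ := exists_deriv_eq_slope chi (by norm_num : (1 : ℝ) < 2)
    chi_contDiff.continuous.continuousOn
    ((chi_contDiff.differentiable (by simp)).differentiableOn)
  refine ⟨s, hs, ?_⟩
  rw [chi₁, hds, chi_eq_zero le_rfl, chi_eq_one le_rfl]
  norm_num

/-- **The radial moment is positive.** [folklore] -/
theorem integral_mom_pos : 0 < ∫ y, mom y := by
  obtain ⟨s, ⟨hs1, hs2⟩, hds⟩ := exists_chi₁_eq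
  set a : ℝ := Real.sqrt (s / 2) with ha
  have ha2 : a ^ 2 = s / 2 := by rw [ha, Real.sq_sqrt (by linarith)]
  have hapos : 0 < a := Real.sqrt_pos.mpr (by linarith)
  have hval : mom ![a, a, 0] ≠ 0 := by
    have hq : qI ![a, a, 0] = s := by simp [qI, Matrix.cons_val_two]; nlinarith [ha2]
    simp only [mom, wA, hq, hds]
    simp
    exact ⟨(chi_pos hs2).ne', hapos.ne'⟩
  exact continuous_mom.integral_pos_of_hasCompactSupport_nonneg_nonzero hasCompactSupport_mom
    mom_nonneg hval

/-! ### The refutations -/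

/-- **The stretching integral of the witness is `−(20/81) M < 0`.** [folklore] -/
theorem stretch_wit : stretch wit = -(20 / 81) * ∫ y, mom y := by
  have hE : Integrable gE := continuous_gE.integrable_of_hasCompactSupport hasCompactSupport_gE
  have hX : Integrable gX := continuous_gX.integrable_of_hasCompactSupport hasCompactSupport_gX
  have hY : Integrable gY := continuous_gY.integrable_of_hasCompactSupport hasCompactSupport_gY
  rw [stretch_wit_eq_integral]
  simp_rw [integrandF_eq]
  have hEX : Integrable fun y => gE y + gX y := hE.add hX
  rw [integral_add hEX hY, integral_add hE hX, integral_gX, integral_gY, integral_gE]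
  ring

/-- The stretching integral of the witness is negative. [folklore] -/
theorem stretch_wit_neg : stretch wit < 0 := by
  rw [stretch_wit]
  linarith [integral_mom_pos]

/-- **Refutation of the load-bearing Step 4 at its printed (kinematic) grain** (arXiv 1207.1090 v3,
(26), TeX l.157–161, print p.3: "the integral involving the perpendicular part vanishes"): the
explicit smooth, compactly supported, divergence-free field
`v(x) = χ(x₀² + 4x₁² + 9x₂²) · (x₂ − x₁, (x₀ − x₂)/4, (x₁ − x₀)/9)`,
`χ(s) = smoothTransition (2 − s)`,
is a datum of the typed class with `∫ ⟪ω, (∇ × ω) × u_⊥⟫ = ∫ ⟪ω, (∇ × ω) × v⟫ = −(20/81) M < 0`,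
`M = ∫ χ(|y|²)χ'(|y|²)² y₀²y₁² dy > 0`. [cite: Lindgren2012, (26) p.3] -/
theorem not_Step4_VanishingIntegral_kinematic : ¬ Step4_VanishingIntegral_kinematic := by
  intro h
  have h0 := h wit isDatum_wit
  rw [stretchPerp_eq] at h0
  exact stretch_wit_neg.ne h0

/-- **Refutation of Step 4 on the solution path**: evolving the witness by the (proved) local
existence theorem in the Beale–Kato–Majda class (`MajdaBertozzi2002_localExistenceH3_holds`,
viscosity `1`) gives a solution of the typed class on some `[0, τ]` whose time-`0` slice has
non-vanishing perpendicular stretching integral. [cite: Lindgren2012, (26) p.3] -/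
theorem not_Step4_VanishingIntegral : ¬ Step4_VanishingIntegral := by
  intro h
  have hH : ∀ n : ℕ, ∫⁻ x, ‖iteratedFDeriv ℝ n wit x‖ₑ ^ 2 < ⊤ := isDatum_wit.2.2
  have hS : (∑ n ∈ Finset.range 4, ∫⁻ x, ‖iteratedFDeriv ℝ n wit x‖ₑ ^ 2) ≠ ⊤ :=
    ENNReal.sum_ne_top.mpr fun n _ => (hH n).ne
  obtain ⟨τ, hτ, hex⟩ := MajdaBertozzi2002_localExistenceH3_holds (ν := 1) zero_le_one
    ((∑ n ∈ Finset.range 4, ∫⁻ x, ‖iteratedFDeriv ℝ n wit x‖ₑ ^ 2).toNNReal)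
  obtain ⟨u, p, hsol, hu0, hB⟩ := hex contDiff_wit isDivFree_wit hH (ENNReal.coe_toNNReal hS).ge
  have h0 := h 1 τ u p one_pos hτ ⟨hsol, hB⟩ 0 ⟨le_rfl, hτ.le⟩
  rw [hu0, stretchPerp_eq] at h0
  exact stretch_wit_neg.ne h0

end Summit.NavierStokesRegularity.NavierStokesRegularity.Theorems.Lindgren2012

end
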